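import Literature.AlgebraicGeometry.GroupSchemes.BarsottiTateGroupFixedPartMap       -- ★ (O-BTε) `fixBTGroup`, `fixBTGroupι`, `fixBTGroupRetract`, `fixRestrict`, `comp_fixBTGroupι_injective`
import Literature.AlgebraicGeometry.GroupSchemes.BTGroupNilpotentPoints              -- ★ `IsRingActionBT`
import Literature.AlgebraicGeometry.GroupSchemes.AffineGroupSchemeOfHopfAlgebra       -- ★ `AffineGroupScheme.Alg.comap` (`Γ(g)` as an `R`-algebra map), `comap_id`, `comap_comp`
import Literature.AlgebraicGeometry.GroupSchemes.HopfIdealOfClosedSubgroup            -- ★ `isAffine_left_of_isClosedImmersion`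
import Mathlib.RingTheory.Ideal.Cotangent
import HarnessLib

/-!
# Cotangent spaces and ring actions of the fixed part of an idempotent endomorphism of a Barsotti–Tate group
# ([Tate 1967] §2 (2.1)–(2.2); [Görtz–Wedhorn I] (6.4), Def. 4.45 (2))

Topic `Literature/AlgebraicGeometry/GroupSchemes`; namespace `Literature.AlgebraicGeometry.GroupSchemes`.  THEOREMS ONLY; no definition, no named
fact, no instance, no notation, no `sorry`.  Cell `hodgecm-mathlib` (D-0151), P6 «MOD programme», K∕BT desk F0P6d-plan (g2), K∕BT CUT v2
«BLOCK-AT-A-POINT» DEAL 1 (memo `F0/P6/F0P6d-plan/KBT-CUT.v2.F0P6dplan-g2.md` §2): the BT-side INPUT glue of the ★-boxed P6b kit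
`blockNumerics_of_line` — its binders `htan`∕`hdim` (unit cotangent ranks of the block `Fix ε`) and `hβ : IsRingActionBT (Fix ε) β` are produced
here from the ambient Barsotti–Tate group `B` and an idempotent `ε` commuting with the action.  HC_CM is proved only modulo the printed citations
until rung 0 closes; nothing here is about HC.

THE PRINT.  [GortzWedhorn2020] (6.4) Def. 6.2 ∕ Prop. 6.7: the Zariski cotangent space of a `k`-group scheme at the unit is `I ∕ I²`, `I = ker Γ(η)`
the augmentation ideal, contravariantly functorial in homomorphisms (Mathlib `Ideal.mapCotangent`).  A RETRACT `j : X ↪ Y`, `r : Y ↠ X`, `j ≫ r = 𝟙`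
of group schemes gives a retract of cotangent spaces: `cot(j) ∘ cot(r) = id`, so `cot(X)` is identified with the image of the idempotent
`cot(r ≫ j)` on `cot(Y)`, `dim cot(X) = rk cot(r ≫ j)`.  [Tate1967] §2 (2.1)–(2.2) with ★ `BarsottiTateGroupFixedPart{,Map}`: the fixed part
`Fix ε` of an idempotent endomorphism of a Barsotti–Tate group is a retract layer-wise (`ι ≫ r = 𝟙`, `r ≫ ι = ε`), and an endomorphism commuting
with `ε` restricts (`fixRestrict`); a RING ACTION commuting with `ε` restricts AS A RING ACTION.

MAIN STATEMENTS.  §1 (generic, `k` a field; affine group objects `X Y` of `Over (Spec k)`): `comap_ker_unit_eq` (augmentation ideals pull back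
along homomorphisms), `mapCotangent_unit_comp_apply` ∕ `mapCotangent_unit_id_apply` (functoriality of the unit cotangent), and the RETRACT LEMMA
`mapCotangent_unit_surjective_of_retract`, `mapCotangent_unit_injective_of_retract`, `range_mapCotangent_unit_eq_of_retract`,
**`finrank_cotangent_unit_eq_finrank_range_of_retract`**; §2 BT form **`BTGroup.Hom.finrank_cotangent_fixLayer_eq`**; §3
**`BTGroup.Hom.isRingActionBT_fixRestrict`**.

## References
* [Tate1967] J. T. Tate, *p-divisible groups*, Proc. Conf. Local Fields (Driebergen, 1966), Springer (1967), §2 (2.1)–(2.2).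
* [GortzWedhorn2020] U. Görtz, T. Wedhorn, *Algebraic Geometry I* (2nd ed., 2020), (6.4) Definition 6.2, Proposition 6.7; Definition 4.45 (2) (p. 117).
-/

set_option autoImplicit false

noncomputable section

universe u v

open CategoryTheory CategoryTheory.Limits AlgebraicGeometry MonoidalCategory CartesianMonoidalCategory
open scoped MonObj

namespace Literature.AlgebraicGeometry.GroupSchemes

open AffineGroupScheme

/-! ## §1 The unit cotangent space is a contravariant functor; retracts of group schemes give retracts of cotangent spaces -/

section Retract

variable {k : Type u} [Field k] {X Y Z : Over (Spec (.of k))} [GrpObj X] [GrpObj Y] [GrpObj Z]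

/-- **Augmentation ideals pull back along homomorphisms**: `ker Γ(η_Y) = Γ(φ)⁻¹ (ker Γ(η_X))` for a homomorphism `φ : X → Y` (`η_Y = η_X ≫ φ`).
[cite: GortzWedhorn2020, (6.4) Definition 6.2] -/
theorem comap_ker_unit_eq (φ : X ⟶ Y) [IsMonHom φ] :
    (RingHom.ker ((η[X] : 𝟙_ (Over (Spec (.of k))) ⟶ X).left.appTop.hom) : Ideal (Alg X)).comap (Alg.comap φ) =
      (RingHom.ker ((η[Y] : 𝟙_ (Over (Spec (.of k))) ⟶ Y).left.appTop.hom) : Ideal (Alg Y)) := by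
  have hη : (η[Y] : 𝟙_ (Over (Spec (.of k))) ⟶ Y) = η[X] ≫ φ := (IsMonHom.one_hom (f := φ)).symm
  ext a
  rw [Ideal.mem_comap, RingHom.mem_ker, RingHom.mem_ker, Alg.comap_apply, hη, Over.comp_left, Scheme.Hom.comp_appTop, CommRingCat.hom_comp]
  rfl

/-- The inclusion form used by Mathlib's `Ideal.mapCotangent`. [cite: GortzWedhorn2020, (6.4) Definition 6.2] -/
theorem ker_unit_le_comap (φ : X ⟶ Y) [IsMonHom φ] :
    (RingHom.ker ((η[Y] : 𝟙_ (Over (Spec (.of k))) ⟶ Y).left.appTop.hom) : Ideal (Alg Y)) ≤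
      (RingHom.ker ((η[X] : 𝟙_ (Over (Spec (.of k))) ⟶ X).left.appTop.hom) : Ideal (Alg X)).comap (Alg.comap φ) :=
  (comap_ker_unit_eq φ).ge

/-- **Functoriality**: the unit-cotangent map of `φ ≫ ψ` is (cotangent map of `φ`) ∘ (cotangent map of `ψ`) — contravariance.
[cite: GortzWedhorn2020, (6.4) Proposition 6.7] -/
theorem mapCotangent_unit_comp_apply (φ : X ⟶ Y) [IsMonHom φ] (ψ : Y ⟶ Z) [IsMonHom ψ]
    (t : (RingHom.ker ((η[Z] : 𝟙_ (Over (Spec (.of k))) ⟶ Z).left.appTop.hom) : Ideal (Alg Z)).Cotangent) :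
    Ideal.mapCotangent _ _ (Alg.comap φ) (ker_unit_le_comap φ) (Ideal.mapCotangent _ _ (Alg.comap ψ) (ker_unit_le_comap ψ) t) =
      Ideal.mapCotangent _ _ (Alg.comap (φ ≫ ψ)) (ker_unit_le_comap (φ ≫ ψ)) t := by
  obtain ⟨⟨a, ha⟩, rfl⟩ := Ideal.toCotangent_surjective _ t
  rw [Ideal.mapCotangent_toCotangent, Ideal.mapCotangent_toCotangent, Ideal.mapCotangent_toCotangent]
  rfl

/-- The unit-cotangent map of the identity is the identity. [cite: GortzWedhorn2020, (6.4) Proposition 6.7] -/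
theorem mapCotangent_unit_id_apply (t : (RingHom.ker ((η[X] : 𝟙_ (Over (Spec (.of k))) ⟶ X).left.appTop.hom) : Ideal (Alg X)).Cotangent) :
    Ideal.mapCotangent _ _ (Alg.comap (𝟙 X)) (ker_unit_le_comap (𝟙 X)) t = t := by
  obtain ⟨⟨a, ha⟩, rfl⟩ := Ideal.toCotangent_surjective _ t
  rw [Ideal.mapCotangent_toCotangent]
  rfl

variable (j : X ⟶ Y) [IsMonHom j] (r : Y ⟶ X) [IsMonHom r] (hjr : j ≫ r = 𝟙 X)

include hjr in
/-- **RETRACT LEMMA (1): `cot(j) ∘ cot(r) = id`** for a retract `j ≫ r = 𝟙_X` of group schemes. [cite: GortzWedhorn2020, (6.4) Proposition 6.7] [cite: Tate1967, §2 (2.1)] -/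
theorem mapCotangent_unit_comp_apply_of_retract
    (t : (RingHom.ker ((η[X] : 𝟙_ (Over (Spec (.of k))) ⟶ X).left.appTop.hom) : Ideal (Alg X)).Cotangent) :
    Ideal.mapCotangent _ _ (Alg.comap j) (ker_unit_le_comap j) (Ideal.mapCotangent _ _ (Alg.comap r) (ker_unit_le_comap r) t) = t := by
  rw [mapCotangent_unit_comp_apply]
  obtain ⟨⟨a, ha⟩, rfl⟩ := Ideal.toCotangent_surjective _ t
  rw [Ideal.mapCotangent_toCotangent]
  congr 1
  apply Subtype.ext
  change (Alg.comap (j ≫ r)) a = a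
  rw [hjr, Alg.comap_id]
  rfl

include hjr in
/-- **RETRACT LEMMA (2): the cotangent map of `j` is SURJECTIVE.** [cite: GortzWedhorn2020, (6.4) Proposition 6.7] [cite: Tate1967, §2 (2.1)] -/
theorem mapCotangent_unit_surjective_of_retract :
    Function.Surjective (Ideal.mapCotangent _ _ (Alg.comap j) (ker_unit_le_comap j)) :=
  fun t => ⟨_, mapCotangent_unit_comp_apply_of_retract j r hjr t⟩

include hjr in
/-- **RETRACT LEMMA (3): the cotangent map of `r` is INJECTIVE.** [cite: GortzWedhorn2020, (6.4) Proposition 6.7] [cite: Tate1967, §2 (2.1)] -/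
theorem mapCotangent_unit_injective_of_retract :
    Function.Injective (Ideal.mapCotangent _ _ (Alg.comap r) (ker_unit_le_comap r)) :=
  Function.LeftInverse.injective (mapCotangent_unit_comp_apply_of_retract j r hjr)

include hjr in
/-- **RETRACT LEMMA (4): the range of `cot(r)` is the range of the idempotent `cot(e)`, `e = r ≫ j`, on `cot(Y)`.**
[cite: GortzWedhorn2020, (6.4) Proposition 6.7] [cite: Tate1967, §2 (2.1)] -/
theorem range_mapCotangent_unit_eq_of_retract (e : Y ⟶ Y) [IsMonHom e] (hrj : r ≫ j = e) :
    LinearMap.range (Ideal.mapCotangent _ _ (Alg.comap r) (ker_unit_le_comap r)) =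
      LinearMap.range (Ideal.mapCotangent _ _ (Alg.comap e) (ker_unit_le_comap e)) := by
  subst hrj
  apply le_antisymm
  · rintro _ ⟨t, rfl⟩
    obtain ⟨s, rfl⟩ := mapCotangent_unit_surjective_of_retract j r hjr t
    exact ⟨s, (mapCotangent_unit_comp_apply r j s).symm⟩
  · rintro _ ⟨s, rfl⟩
    exact ⟨_, mapCotangent_unit_comp_apply r j s⟩

include hjr in
/-- **RETRACT LEMMA (5): `dim_k cot(X) = rk_k cot(e)`, `e = r ≫ j`** — the unit cotangent space of a retract `X` of `Y` is as big as the image of the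
idempotent `cot(e)` on `cot(Y)`. [cite: GortzWedhorn2020, (6.4) Proposition 6.7] [cite: Tate1967, §2 (2.1)] -/
theorem finrank_cotangent_unit_eq_finrank_range_of_retract (e : Y ⟶ Y) [IsMonHom e] (hrj : r ≫ j = e) :
    Module.finrank k (RingHom.ker ((η[X] : 𝟙_ (Over (Spec (.of k))) ⟶ X).left.appTop.hom) : Ideal (Alg X)).Cotangent =
      Module.finrank k (LinearMap.range (Ideal.mapCotangent _ _ (Alg.comap e) (ker_unit_le_comap e))) := by
  rw [← range_mapCotangent_unit_eq_of_retract j r hjr e hrj]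
  exact (LinearMap.finrank_range_of_inj (mapCotangent_unit_injective_of_retract j r hjr)).symm

end Retract

/-! ## §2 BT form: the unit cotangent ranks of the layers of `Fix ε` -/

namespace BTGroup

namespace Hom

variable {k : Type u} [Field k] {p h : ℕ} {B : BTGroup (Spec (.of k)) p h} (ε : Hom B B)
  (hε : ∀ n, ε.app n ≫ ε.app n = ε.app n) (h₁ : ℕ) (hrank : ∀ n (s : Spec (.of k)), (ε.fixLayer n).hom.finrank s = p ^ (n * h₁))

/-- **`dim_k cot((Fix ε)_n) = rk_k cot(ε_n)`**: the unit cotangent space of the `n`-th layer of the fixed part of an idempotent endomorphism `ε` of a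
Barsotti–Tate group over a field has the dimension of the range of the cotangent map of `ε_n` on `cot(B.G n)` — §1 for the retract `ι_n ≫ r_n = 𝟙`,
`r_n ≫ ι_n = ε_n` (★ `fixBTGroupι_comp_fixBTGroupRetract`, `fixBTGroupRetract_comp_fixBTGroupι`).  This is how the block `Fix ε` inherits the kit's
`htan`∕`hdim`. [cite: Tate1967, §2 (2.1)–(2.2)] [cite: GortzWedhorn2020, (6.4) Proposition 6.7] -/
theorem finrank_cotangent_fixLayer_eq (n : ℕ) :
    letI := B.grpObj n; letI := (ε.fixBTGroup hε h₁ hrank).grpObj n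
    Module.finrank k (RingHom.ker ((η[(ε.fixBTGroup hε h₁ hrank).G n] : 𝟙_ (Over (Spec (.of k))) ⟶ _).left.appTop.hom) :
        Ideal (Alg ((ε.fixBTGroup hε h₁ hrank).G n))).Cotangent =
      haveI := ε.isMonHom_app n
      Module.finrank k (LinearMap.range (Ideal.mapCotangent _ _ (Alg.comap (ε.app n)) (ker_unit_le_comap (ε.app n)))) := by
  letI := B.grpObj n
  letI := (ε.fixBTGroup hε h₁ hrank).grpObj n
  haveI := ε.isMonHom_app n
  haveI : IsMonHom ((ε.fixBTGroupι hε h₁ hrank).app n) := (ε.fixBTGroupι hε h₁ hrank).isMonHom_app n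
  haveI : IsMonHom ((ε.fixBTGroupRetract hε h₁ hrank).app n) := (ε.fixBTGroupRetract hε h₁ hrank).isMonHom_app n
  have hjr : (ε.fixBTGroupι hε h₁ hrank).app n ≫ (ε.fixBTGroupRetract hε h₁ hrank).app n = 𝟙 _ := by
    have h := congrArg (fun F => Hom.app F n) (ε.fixBTGroupι_comp_fixBTGroupRetract hε h₁ hrank)
    simpa only [comp_app, id_app] using h
  have hrj : (ε.fixBTGroupRetract hε h₁ hrank).app n ≫ (ε.fixBTGroupι hε h₁ hrank).app n = ε.app n := by
    have h := congrArg (fun F => Hom.app F n) (ε.fixBTGroupRetract_comp_fixBTGroupι hε h₁ hrank)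
    simpa only [comp_app] using h
  exact finrank_cotangent_unit_eq_finrank_range_of_retract _ _ hjr (ε.app n) hrj

/-! ## §3 A ring action commuting with `ε` restricts to `Fix ε` as a ring action -/

/-- **`IsRingActionBT (Fix ε) (fixRestrict ∘ β)`**: a ring action `β` of `𝒪` on `B` whose every `β a` commutes with the idempotent `ε` (layer-wise)
restricts (★ `fixRestrict`) to a RING ACTION on the fixed part: `1 ↦ id`, products and sums are checked after the layer monomorphisms `ι_n`
(homomorphisms), where they are the identities for `β`.  The connected-part instance ★ `BTGroup.isRingActionBT_connectedPartAction` (file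
`BarsottiTateGroupConnectedPart`, `ε := connectedEtaleIdem`) is the special case recovered by one `exact` (cite-not-restate). [cite: Tate1967, §2 (2.1)–(2.2)] [cite: GortzWedhorn2020, Definition 4.45 (2) (p. 117)] -/
theorem isRingActionBT_fixRestrict {𝒪 : Type v} [CommRing 𝒪] (β : 𝒪 → Hom B B) (hβ : IsRingActionBT B β)
    (hcomm : ∀ a n, (β a).app n ≫ ε.app n = ε.app n ≫ (β a).app n) :
    IsRingActionBT (ε.fixBTGroup hε h₁ hrank) (fun a => fixRestrict ε hε h₁ hrank ε hε h₁ hrank (β a) (hcomm a)) := by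
  obtain ⟨hone, hmul, hadd⟩ := hβ
  have hι : ∀ c : 𝒪, (fixRestrict ε hε h₁ hrank ε hε h₁ hrank (β c) (hcomm c)).comp (ε.fixBTGroupι hε h₁ hrank) =
      (ε.fixBTGroupι hε h₁ hrank).comp (β c) := fun c => fixRestrict_comp_fixBTGroupι _ _ _ _ _ _ _ _ _ _
  refine ⟨?_, fun a b => ?_, fun a b n => ?_⟩
  · -- `β⁰ 1 = id`
    apply comp_fixBTGroupι_injective ε hε h₁ hrank
    rw [hι, hone, Hom.comp_id, Hom.id_comp]
  · -- `β⁰ (a * b) = β⁰ b ∘ β⁰ a`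
    apply comp_fixBTGroupι_injective ε hε h₁ hrank
    rw [hι, hmul, Hom.comp_assoc, hι, ← Hom.comp_assoc (fixRestrict ε hε h₁ hrank ε hε h₁ hrank (β b) (hcomm b)), hι, Hom.comp_assoc]
  · -- additivity on the `n`-th layer, after the monomorphic homomorphism `ι_n`
    letI := B.grpObj n
    haveI := B.comm n
    letI := (ε.fixBTGroup hε h₁ hrank).grpObj n
    haveI : IsMonHom ((ε.fixBTGroupι hε h₁ hrank).app n) := (ε.fixBTGroupι hε h₁ hrank).isMonHom_app n
    haveI : Mono ((ε.fixBTGroupι hε h₁ hrank).app n) := ε.mono_fixLayerι n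
    have hιn : ∀ c : 𝒪, (fixRestrict ε hε h₁ hrank ε hε h₁ hrank (β c) (hcomm c)).app n ≫ (ε.fixBTGroupι hε h₁ hrank).app n =
        (ε.fixBTGroupι hε h₁ hrank).app n ≫ (β c).app n := fun c => congrArg (fun K => Hom.app K n) (hι c)
    rw [← cancel_mono ((ε.fixBTGroupι hε h₁ hrank).app n), hιn, hadd a b n, comp_lift_assoc, ← hιn a, ← hιn b, ← lift_map_assoc,
      Category.assoc, ← IsMonHom.mul_hom]

end Hom

end BTGroup

end Literature.AlgebraicGeometry.GroupSchemes

end
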